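/-
Copyright (c) 2026 the pub-hodgecm-mathlib formalisation cell (harness21).  Prover seat hodgecm-mathlib-K2-defs1 (g6), Track B, h413 = `stmt-HodgeConjecture-24833`, route `HCCMUnconditional`,
deal (261) of dealer K2E1-plan (g7) 2026-09-04T13:48:23Z: GENERIC-EIGENVALUE EDITION 3 — X2_χ (A) at CM (★ K2E1-p14 `chiEisenstein_meromorphic_exports_cm_two_of_letters`) in the ŝ-currency.
-/
import Summits.HodgeConjecture.HodgeConjecture.Theorems.K2E1ChiEisensteinBallPackageCMTwoEigen            -- 📤 (this seat): X1_χ §2c generic-eigenvalue edition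
import Summits.HodgeConjecture.HodgeConjecture.Theorems.K2E1ChiEisensteinMeromorphicExportsU2GlobalEigen  -- ★ p860182 (K2E1-p14): X2_χ core generic-eigenvalue edition
import Summits.HodgeConjecture.HodgeConjecture.Theorems.K2E1ChiEisensteinMeromorphicExportsU2GlobalCM     -- ★ (K2E1-p14): `meromorphicOn_apply_of_pi` and the ĥ-currency print
import HarnessLib

/-!
# `K2E1ChiEisensteinMeromorphicExportsU2GlobalCMEigen` — GENERIC-EIGENVALUE EDITION of ★ `chiEisenstein_meromorphic_exports_cm_two_of_letters` (X2_χ (A) at the CM pair): the GLOBAL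
# meromorphic exports of `E(f_z^φ)` and of its scattering coordinates, HYPOTHESIS-FIRST on `hq`∕`hqφ` and on the per-ball letter bundle `hCD` — now in the EIGENVALUE currency: `hCD n` is
# LITERALLY the conclusion of ★ `exists_chi_convData_cm_two` at `V := chiSectionSpace χ K′ ω` (so ★ p860739 `exists_chi_convData_level_cm_two` discharges it at ANY level)

Cell `pub/hodgecm-mathlib`, crux H413 = `stmt-HodgeConjecture-24833`.  THEOREMS ONLY (no `def`, no `instance`, no notation, no named-fact hypothesis, no `sorry`); lane `--supports
stmt-HodgeConjecture-24833 --as helper` (count-neutral).  Closes no socket.  Proof = ★'s VERBATIM with 📤 `exists_chi_ball_package_cm_two_of_eigen` for §2c and ★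
`chiEisenstein_meromorphic_exports_core_of_packages_of_eigen` (p860182) for the core; the scalar-action clause is fed from `hCD`'s ACTION clause `∫ h_i·f_z^φ(x·) = ŝ_i(z)·f_z^φ(x)`.
[BernsteinLapid2019, Thm 2.3, §2.1, §4, §7; MoeglinWaldspurger1995, II.1.7, IV.1.8–IV.1.11]
* HEAD **`chiEisenstein_meromorphic_exports_cm_two_of_letters_of_eigen`** (conclusion (E1)–(E4) byte-identical with ★'s).
HONEST LABEL: HC_CM is proved only modulo the 7 printed citations (2 remaining named inputs: hLiu418 = `stmt-HodgeConjecture-24832`, h413 = `stmt-HodgeConjecture-24833`) until rung 0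
closes; count-neutral helper, closes no socket.

## References
* [BernsteinLapid2019] J. Bernstein, E. Lapid, *On the meromorphic continuation of Eisenstein series*, J. AMS 37 (2024), Thm 2.3, §2.1, §4, §7.
* [MoeglinWaldspurger1995] C. Mœglin, J.-L. Waldspurger, *Spectral Decomposition and Eisenstein Series* (1995), II.1.7, IV.1.8–IV.1.11.
-/

set_option autoImplicit false
set_option linter.dupNamespace false  -- the mandated namespace repeats the summit's segment (`HodgeConjecture.HodgeConjecture`)

noncomputable section

open MeasureTheory Measure Filter Topology Set NumberField IsDedekindDomain
open scoped NNReal ENNReal Classical ComplexConjugate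
open Literature.MeasureTheory.Group Literature.NumberTheory Literature.NumberTheory.Automorphic Literature.NumberTheory.Automorphic.UnitaryGroup AdelicGroupData
open Literature.NumberTheory.GaloisRepresentations (HeckeCharacter)
open Summit.HodgeConjecture.HodgeConjecture.Cruxes.H413.K2E1BorelEisensteinU
open Summit.HodgeConjecture.HodgeConjecture.Cruxes.H413.K2E1BLBorelSpacesU2Defs
open Summit.HodgeConjecture.HodgeConjecture.Cruxes.H413.K2E1BLBorelOperatorsU2Defs
open Summit.HodgeConjecture.HodgeConjecture.Cruxes.H413.K2E1CharacterEisensteinU2Defs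
open Summit.HodgeConjecture.HodgeConjecture.Cruxes.H413.K2E1ChiSectionSpaceU2Defs
open Summit.HodgeConjecture.HodgeConjecture.Cruxes.H413.K2E1ChiEisensteinBallPackageCMTwoScalar (exists_chi_ball_package_cm_two_of_letters')
open Summit.HodgeConjecture.HodgeConjecture.Cruxes.H413.K2E1ChiEisensteinMeromorphicExportsU2Global (chiEisenstein_meromorphic_exports_core_of_packages meromorphicOn_patch_of_coDiscrete)
open Summit.HodgeConjecture.HodgeConjecture.Cruxes.H413.K2E1BLIotaClosedEmbeddingU2 (iotaBound_cm)

open Summit.HodgeConjecture.HodgeConjecture.Cruxes.H413.K2E1ChiEisensteinMeromorphicExportsU2GlobalCM (meromorphicOn_apply_of_pi)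
open Summit.HodgeConjecture.HodgeConjecture.Cruxes.H413.K2E1ChiEisensteinBallPackageCMTwoEigen (exists_chi_ball_package_cm_two_of_eigen)
open Summit.HodgeConjecture.HodgeConjecture.Cruxes.H413.K2E1ChiEisensteinMeromorphicExportsU2GlobalEigen (chiEisenstein_meromorphic_exports_core_of_packages_of_eigen)

namespace Summit.HodgeConjecture.HodgeConjecture.Cruxes.H413.K2E1ChiEisensteinMeromorphicExportsU2GlobalCMEigen

variable (L : Type) [Field L] [NumberField L] [IsCMField L]
  [MeasurableSpace (quasiSplit (↥(maximalRealSubfield L)) L (IsCMField.complexConj L) 2).Adelic] [BorelSpace (quasiSplit (↥(maximalRealSubfield L)) L (IsCMField.complexConj L) 2).Adelic]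

/-- **X2_χ (A) AT THE CM PAIR, GENERIC-EIGENVALUE EDITION** — ★ `chiEisenstein_meromorphic_exports_cm_two_of_letters` with the letter bundle `hCD` in the ŝ-currency (per ball: the conclusion of ★
`exists_chi_convData_cm_two` at `V := chiSectionSpace χ K′ ω`).  Conclusion (E1)–(E4) unchanged. [cite: BernsteinLapid2019, Thm 2.3, §4, §7] [cite: MoeglinWaldspurger1995, II.1.7, IV.1.8–IV.1.11] -/
theorem chiEisenstein_meromorphic_exports_cm_two_of_letters_of_eigen
    (μ : Measure (quasiSplit (↥(maximalRealSubfield L)) L (IsCMField.complexConj L) 2).automorphicQuotient) [(quasiSplit (↥(maximalRealSubfield L)) L (IsCMField.complexConj L) 2).IsAutomorphicMeasure μ]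
    (νG : Measure (quasiSplit (↥(maximalRealSubfield L)) L (IsCMField.complexConj L) 2).Adelic) [νG.IsHaarMeasure] [νG.IsInvInvariant] [SFinite νG]
    (ν : Measure ↥(adelicUnipotent (↥(maximalRealSubfield L)) L (IsCMField.complexConj L) 2)) [ν.IsHaarMeasure] [ν.IsMulRightInvariant] [ν.IsInvInvariant]
    {𝓕 : Set ↥(adelicUnipotent (↥(maximalRealSubfield L)) L (IsCMField.complexConj L) 2)}
    (h𝓕N : IsFundamentalDomain ↥(rationalUnipotent (↥(maximalRealSubfield L)) L (IsCMField.complexConj L) 2) 𝓕 ν) (h𝓕c : IsCompact (closure 𝓕)) (h𝓕₀ : ν 𝓕 ≠ 0)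
    {β : (quasiSplit (↥(maximalRealSubfield L)) L (IsCMField.complexConj L) 2).Adelic → ℝ≥0∞}
    (hβ : IsCoveringWeight ↥((arithmeticBorel (↥(maximalRealSubfield L)) L (IsCMField.complexConj L) 2).map (quasiSplit (↥(maximalRealSubfield L)) L (IsCMField.complexConj L) 2).arithmeticSubgroup.subtype) β)
    {μZ : Measure (borelQuotient (↥(maximalRealSubfield L)) L (IsCMField.complexConj L) 2)} [SFinite μZ]
    (hμZ : ∀ f : borelQuotient (↥(maximalRealSubfield L)) L (IsCMField.complexConj L) 2 → ℝ≥0∞, Measurable f → ∫⁻ z, f z ∂μZ = ∫⁻ g, β g * f (toBorelQuotient (↥(maximalRealSubfield L)) L (IsCMField.complexConj L) 2 g) ∂νG)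
    -- the section data
    {χ : HeckeCharacter L} {K' : Subgroup (quasiSplit (↥(maximalRealSubfield L)) L (IsCMField.complexConj L) 2).Adelic} {ω : ↥K' → ℂ} {φ : (quasiSplit (↥(maximalRealSubfield L)) L (IsCMField.complexConj L) 2).Adelic → ℂ} (hφV : φ ∈ chiSectionSpace χ K' ω) (hφc : Continuous φ) {Mφ : ℝ} (hφM : ∀ x, ‖φ x‖ ≤ Mφ)
    {ι' : Type} [Fintype ι'] {φ' : ι' → (quasiSplit (↥(maximalRealSubfield L)) L (IsCMField.complexConj L) 2).Adelic → ℂ} (hli : LinearIndependent ℂ φ') (hφ'c : ∀ j, Continuous (φ' j))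
    (hφ'χ : ∀ j, IsChiSection (reflectChar (IsCMField.complexConj L) χ) (φ' j)) {Mb : ℝ} (hφ'M : ∀ j x, ‖φ' j x‖ ≤ Mb)
    -- THE LETTERS `hq`∕`hqφ`: the scattering coordinates on the Godement half-plane
    (q : ι' → ℂ → ℂ) (hq : ∀ j, DifferentiableOn ℂ (q j) {z : ℂ | 1 < z.re})
    (hqφ : ∀ z : ℂ, 1 < z.re → (∑ j, q j z • φ' j) = ((((ν 𝓕).toReal⁻¹ : ℝ)) : ℂ) • (fun g : (quasiSplit (↥(maximalRealSubfield L)) L (IsCMField.complexConj L) 2).Adelic => (∫ v : ↥(adelicUnipotent (↥(maximalRealSubfield L)) L (IsCMField.complexConj L) 2), flatSectionU φ z ((quasiSplit (↥(maximalRealSubfield L)) L (IsCMField.complexConj L) 2).toAdelic (weylLongU ((IsCMField.complexConj L : L ≃ₐ[↥(maximalRealSubfield L)] L) : L →+* L) (rfl : (StdForm.antidiagonal 2).over L = (StdForm.antidiagonal 2).over L)) * ((v : (quasiSplit (↥(maximalRealSubfield L)) L (IsCMField.complexConj L) 2).Adelic) * g)) ∂ν) * (((borelHeight g : ℝ) :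 ℂ) ^ (z - 1))))
    -- THE LETTER BUNDLE `hCD` (EIGENVALUE CURRENCY): per ball, EXACTLY the conclusion of ★ `exists_chi_convData_cm_two` at `V := chiSectionSpace χ K′ ω` (★ p860739 at any level)
    (hCD : ∀ n : ℕ,
      ∃ (a : ℝ≥0) (ha : 0 < a) (I : Type) (_ : Fintype I) (i₀ : I) (η : I → GL (Fin 2) (AdeleRing (𝓞 L) L) → ℝ) (κ : I → ℝ≥0)
        (T : I → HX (↥(maximalRealSubfield L)) L (IsCMField.complexConj L) 2 (n + 3) μ →L[ℂ] HX (↥(maximalRealSubfield L)) L (IsCMField.complexConj L) 2 (n + 3) μ) (ŝ : I → ℂ → ℂ),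
        -- the test functions `η_i` (smooth, non-negative, symmetric) and the self-convolutions `h_i = S_{η_i} η_i` (continuous, compactly supported, symmetric, real, `Re ≥ 0`)
        (∀ i, IsTestFunctionGL 2 L (η i) ∧ (∀ g, 0 ≤ η i g) ∧ (∀ g, η i g⁻¹ = η i g)) ∧
        (∀ i, Continuous (fun y : (quasiSplit (↥(maximalRealSubfield L)) L (IsCMField.complexConj L) 2).Adelic => orbitalSmoothing νG (fun x : (quasiSplit (↥(maximalRealSubfield L)) L (IsCMField.complexConj L) 2).Adelic => ((η i (adelicVal (↥(maximalRealSubfield L)) L (IsCMField.complexConj L) 2 ((StdForm.antidiagonal 2).over L) x) : ℝ) : ℂ)) (fun x : (quasiSplit (↥(maximalRealSubfield L)) L (IsCMField.complexConj L) 2).Adelic => ((η i (adelicVal (↥(maximalRealSubfield L)) L (IsCMField.complexConj L) 2 ((StdForm.antidiagonal 2).over L) x) : ℝ) : ℂ)) y) ∧ HasCompactSupport (fun y : (quasiSplit (↥(maximalRealSubfield L)) L (IsCMField.complexConj L) 2).Adelic => orbitalSmoothing νG (fun x : (quasiSplit (↥(maximalRealSubfield L)) L (IsCMField.complexConj L)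 2).Adelic => ((η i (adelicVal (↥(maximalRealSubfield L)) L (IsCMField.complexConj L) 2 ((StdForm.antidiagonal 2).over L) x) : ℝ) : ℂ)) (fun x : (quasiSplit (↥(maximalRealSubfield L)) L (IsCMField.complexConj L) 2).Adelic => ((η i (adelicVal (↥(maximalRealSubfield L)) L (IsCMField.complexConj L) 2 ((StdForm.antidiagonal 2).over L) x) : ℝ) : ℂ)) y) ∧
          (∀ g, (fun y : (quasiSplit (↥(maximalRealSubfield L)) L (IsCMField.complexConj L) 2).Adelic => orbitalSmoothing νG (fun x : (quasiSplit (↥(maximalRealSubfield L)) L (IsCMField.complexConj L) 2).Adelic => ((η i (adelicVal (↥(maximalRealSubfield L)) L (IsCMField.complexConj L) 2 ((StdForm.antidiagonal 2).over L) x) : ℝ) : ℂ)) (fun x : (quasiSplit (↥(maximalRealSubfield L)) L (IsCMField.complexConj L) 2).Adelic => ((η i (adelicVal (↥(maximalRealSubfield L)) L (IsCMField.complexConj L) 2 ((StdForm.antidiagonal 2).over L) x) : ℝ) : ℂ)) y) g⁻¹ = (fun y : (quasiSplit (↥(maximalRealSubfield L)) L (IsCMField.complexConj L) 2).Adelic =>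 orbitalSmoothing νG (fun x : (quasiSplit (↥(maximalRealSubfield L)) L (IsCMField.complexConj L) 2).Adelic => ((η i (adelicVal (↥(maximalRealSubfield L)) L (IsCMField.complexConj L) 2 ((StdForm.antidiagonal 2).over L) x) : ℝ) : ℂ)) (fun x : (quasiSplit (↥(maximalRealSubfield L)) L (IsCMField.complexConj L) 2).Adelic => ((η i (adelicVal (↥(maximalRealSubfield L)) L (IsCMField.complexConj L) 2 ((StdForm.antidiagonal 2).over L) x) : ℝ) : ℂ)) y) g) ∧ (∀ g, conj ((fun y : (quasiSplit (↥(maximalRealSubfield L)) L (IsCMField.complexConj L) 2).Adelic => orbitalSmoothing νG (fun x : (quasiSplit (↥(maximalRealSubfield L)) L (IsCMField.complexConj L) 2).Adelic => ((η i (adelicVal (↥(maximalRealSubfield L)) L (IsCMField.complexConj L) 2 ((StdForm.antidiagonal 2).over L) x) : ℝ) : ℂ)) (fun x : (quasiSplit (↥(maximalRealSubfield L)) L (IsCMField.complexConj L) 2).Adelic => ((η i (adelicVal (↥(maximalRealSubfield L)) L (IsCMField.complexConj L) 2 ((StdForm.antidiagonal 2).over L) x) : ℝ) : ℂ)) y)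 g) = (fun y : (quasiSplit (↥(maximalRealSubfield L)) L (IsCMField.complexConj L) 2).Adelic => orbitalSmoothing νG (fun x : (quasiSplit (↥(maximalRealSubfield L)) L (IsCMField.complexConj L) 2).Adelic => ((η i (adelicVal (↥(maximalRealSubfield L)) L (IsCMField.complexConj L) 2 ((StdForm.antidiagonal 2).over L) x) : ℝ) : ℂ)) (fun x : (quasiSplit (↥(maximalRealSubfield L)) L (IsCMField.complexConj L) 2).Adelic => ((η i (adelicVal (↥(maximalRealSubfield L)) L (IsCMField.complexConj L) 2 ((StdForm.antidiagonal 2).over L) x) : ℝ) : ℂ)) y) g) ∧ (∀ g, 0 ≤ ((fun y : (quasiSplit (↥(maximalRealSubfield L)) L (IsCMField.complexConj L) 2).Adelic => orbitalSmoothing νG (fun x : (quasiSplit (↥(maximalRealSubfield L)) L (IsCMField.complexConj L) 2).Adelic => ((η i (adelicVal (↥(maximalRealSubfield L)) L (IsCMField.complexConj L) 2 ((StdForm.antidiagonal 2).over L) x) : ℝ) : ℂ)) (fun x : (quasiSplit (↥(maximalRealSubfield L)) L (IsCMField.complexConj L) 2).Adelic => ((η i (adelicVal (↥(maximalRealSubfield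 L)) L (IsCMField.complexConj L) 2 ((StdForm.antidiagonal 2).over L) x) : ℝ) : ℂ)) y) g).re)) ∧
        -- the EIGENVALUE FUNCTIONS `ŝ_i` (entire), the scalar action of `h_i` on `V ⊗ H^z`, the cover of the ball, and the non-constant member `i₀`
        (∀ i, Differentiable ℂ (ŝ i)) ∧
        (∀ i, ∀ z : ℂ, ∀ φ ∈ chiSectionSpace χ K' ω, ∀ x : (quasiSplit (↥(maximalRealSubfield L)) L (IsCMField.complexConj L) 2).Adelic, (∫ y, (fun y : (quasiSplit (↥(maximalRealSubfield L)) L (IsCMField.complexConj L) 2).Adelic => orbitalSmoothing νG (fun x : (quasiSplit (↥(maximalRealSubfield L)) L (IsCMField.complexConj L) 2).Adelic => ((η i (adelicVal (↥(maximalRealSubfield L)) L (IsCMField.complexConj L) 2 ((StdForm.antidiagonal 2).over L) x) : ℝ) : ℂ)) (fun x : (quasiSplit (↥(maximalRealSubfield L)) L (IsCMField.complexConj L) 2).Adelic => ((η i (adelicVal (↥(maximalRealSubfield L)) L (IsCMField.complexConj L) 2 ((StdForm.antidiagonal 2).over L) x) : ℝ) : ℂ)) y) y * flatSectionU φ z (x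 * y) ∂νG) = ŝ i z * flatSectionU φ z x) ∧
        (∀ z ∈ Metric.ball (0 : ℂ) (n + 2), ∃ i, ŝ i z ≠ 0) ∧
        (∃ z₁ z₂ : ℂ, ŝ i₀ z₁ ≠ ŝ i₀ z₂) ∧ (∃ z ∈ Metric.ball (0 : ℂ) (n + 2), ŝ i₀ z ≠ 0) ∧
        (∀ i, 1 ≤ κ i ∧ a ≤ κ i * a) ∧
        (∀ i, ∀ z : borelQuotient (↥(maximalRealSubfield L)) L (IsCMField.complexConj L) 2, ∀ y ∈ tsupport (fun y : (quasiSplit (↥(maximalRealSubfield L)) L (IsCMField.complexConj L) 2).Adelic => orbitalSmoothing νG (fun x : (quasiSplit (↥(maximalRealSubfield L)) L (IsCMField.complexConj L) 2).Adelic => ((η i (adelicVal (↥(maximalRealSubfield L)) L (IsCMField.complexConj L) 2 ((StdForm.antidiagonal 2).over L) x) : ℝ) : ℂ)) (fun x : (quasiSplit (↥(maximalRealSubfield L)) L (IsCMField.complexConj L) 2).Adelic => ((η i (adelicVal (↥(maximalRealSubfield L)) L (IsCMField.complexConj L) 2 ((StdForm.antidiagonal 2).over L) x) : ℝ) : ℂ))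 y), borelQuotHeight (↥(maximalRealSubfield L)) L (IsCMField.complexConj L) 2 z ≤ κ i * borelQuotHeight (↥(maximalRealSubfield L)) L (IsCMField.complexConj L) 2 (rightShift (↥(maximalRealSubfield L)) L (IsCMField.complexConj L) 2 y z)) ∧
        (∀ i, ∃ hpos : 0 < κ i * a, Function.Injective (iota (iotaBound_cm L μ νG hβ hμZ hpos (n + 3))) ∧
          IsClosed ((LinearMap.range (iota (iotaBound_cm L μ νG hβ hμZ hpos (n + 3))).toLinearMap :
            Submodule ℂ (HN (↥(maximalRealSubfield L)) L (IsCMField.complexConj L) 2 (n + 3) (κ i * a) μZ)) : Set (HN (↥(maximalRealSubfield L)) L (IsCMField.complexConj L) 2 (n + 3) (κ i * a) μZ))) ∧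
        μZ {z | a < borelQuotHeight (↥(maximalRealSubfield L)) L (IsCMField.complexConj L) 2 z} ≠ 0 ∧
        (∀ i, ∀ u : HX (↥(maximalRealSubfield L)) L (IsCMField.complexConj L) 2 (n + 3) μ,
          (T i u : (quasiSplit (↥(maximalRealSubfield L)) L (IsCMField.complexConj L) 2).automorphicQuotient → ℂ) =ᵐ[μ.withDensity fun x =>
              (((supHeight (↥(maximalRealSubfield L)) L (IsCMField.complexConj L) 2 x)⁻¹ ^ (2 * (n + 3)) : ℝ≥0) : ℝ≥0∞)]
            fun ξ => ∫ y, (fun y : (quasiSplit (↥(maximalRealSubfield L)) L (IsCMField.complexConj L) 2).Adelic => orbitalSmoothing νG (fun x : (quasiSplit (↥(maximalRealSubfield L)) L (IsCMField.complexConj L) 2).Adelic => ((η i (adelicVal (↥(maximalRealSubfield L)) L (IsCMField.complexConj L) 2 ((StdForm.antidiagonal 2).over L) x) : ℝ) : ℂ)) (fun x : (quasiSplit (↥(maximalRealSubfield L)) L (IsCMField.complexConj L) 2).Adelic => ((η i (adelicVal (↥(maximalRealSubfield L)) L (IsCMField.complexConj L) 2 ((StdForm.antidiagonal 2).over L) x)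 : ℝ) : ℂ)) y) y * (u : (quasiSplit (↥(maximalRealSubfield L)) L (IsCMField.complexConj L) 2).automorphicQuotient → ℂ) (y⁻¹ • ξ) ∂νG) ∧
        (∀ i, ∃ hs : ShiftBound (↥(maximalRealSubfield L)) L (IsCMField.complexConj L) 2 (n + 3) a (κ i * a) νG μZ (fun y : (quasiSplit (↥(maximalRealSubfield L)) L (IsCMField.complexConj L) 2).Adelic => orbitalSmoothing νG (fun x : (quasiSplit (↥(maximalRealSubfield L)) L (IsCMField.complexConj L) 2).Adelic => ((η i (adelicVal (↥(maximalRealSubfield L)) L (IsCMField.complexConj L) 2 ((StdForm.antidiagonal 2).over L) x) : ℝ) : ℂ)) (fun x : (quasiSplit (↥(maximalRealSubfield L)) L (IsCMField.complexConj L) 2).Adelic => ((η i (adelicVal (↥(maximalRealSubfield L)) L (IsCMField.complexConj L) 2 ((StdForm.antidiagonal 2).over L) x) : ℝ) : ℂ)) y),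
          ∀ (h01 : a ≤ κ i * a),
            deltaShift hs ∘L iota (iotaBound_cm L μ νG hβ hμZ ha (n + 3)) =
              restrHN (↥(maximalRealSubfield L)) L (IsCMField.complexConj L) 2 (n + 3) h01 μZ ∘L iota (iotaBound_cm L μ νG hβ hμZ ha (n + 3)) ∘L T i)) :
    ∃ (Ec : ℂ → (quasiSplit (↥(maximalRealSubfield L)) L (IsCMField.complexConj L) 2).Adelic → ℂ) (qc : ι' → ℂ → ℂ) (P : Set ℂ),
      (∀ g, MeromorphicNFOn (fun z => Ec z g) univ) ∧ (∀ j, MeromorphicNFOn (qc j) univ) ∧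
      (∀ z : ℂ, 1 < z.re → Ec z = eisensteinSeriesU (flatSectionU φ z)) ∧ (∀ j (z : ℂ), 1 < z.re → qc j z = q j z) ∧
      IsClosed P ∧ (∀ z₀ : ℂ, ∀ᶠ s in 𝓝[≠] z₀, s ∉ P) ∧ (∀ z ∈ P, z.re ≤ 1) ∧
      (∀ g (z : ℂ), z ∉ P → AnalyticAt ℂ (fun z => Ec z g) z) ∧ (∀ j (z : ℂ), z ∉ P → AnalyticAt ℂ (qc j) z) ∧
      (∀ g, DifferentiableOn ℂ (fun z => Ec z g) Pᶜ) ∧ (∀ j, DifferentiableOn ℂ (qc j) Pᶜ) ∧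
      ∀ z : ℂ, z ∉ P → Continuous (Ec z) := by
  -- the per-ball (χ,τ) convolution data WITH eigenvalues, chosen over `n`
  choose a ha I hI i₀ η κ T ŝ hη hconv hŝd hact hcov hnc _hne0 hκ hcmp hι _hμZ hT hpack using hCD
  -- the per-ball packages of 📤 X1_χ §2c-eigen at the coordinates `bX z := (q_j z)_j`
  have P0 := fun n : ℕ => exists_chi_ball_package_cm_two_of_eigen L μ νG ν h𝓕N h𝓕c h𝓕₀ hβ hμZ n (i₀ n) (η n) (ha n) (κ n) (T n) (ŝ n) (hŝd n) (hnc n)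
    (fun i => (hη n i).1) (hconv n) (hcov n) (hκ n) (hcmp n) (hι n) (hT n) (hpack n) hφV hφc hφM hli hφ'c hφ'χ hφ'M (fun z j => q j z) (fun z _ hz1 => hqφ z hz1)
    (fun i z _ x => hact n i z φ hφV x)
  choose U vX cc hb α₁ col hUo hUD hDcl hUcd hvXd hvXm hccd hccm hα₁ae hcolae heqs hunq hgod hR4 using P0
  choose Ecb hEcm hEcg hEco hgerm using hR4
  -- the coefficient pieces: the components of `cc n`, patched to `q_j` on the Godement half-plane (★ `meromorphicOn_patch_of_coDiscrete`)
  have hpatch : ∀ (j : ι') (n : ℕ), MeromorphicOn (fun s => if (1 : ℝ) < s.re then q j s else cc n s j) (Metric.ball (0 : ℂ) (n + 2)) ∧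
      (∀ z ∈ Metric.ball (0 : ℂ) (n + 2), (1 : ℝ) < z.re → (fun s => if (1 : ℝ) < s.re then q j s else cc n s j) z = q j z) ∧
      ∀ z ∈ Metric.ball (0 : ℂ) (n + 2), z ∈ U n → 0 ≤ meromorphicOrderAt (fun s => if (1 : ℝ) < s.re then q j s else cc n s j) z := fun j n =>
    (meromorphicOn_patch_of_coDiscrete (hUo n) (hUcd n) (σ₀ := (1 : ℝ)) (cc := fun z => cc n z j) (q := q j) (differentiableOn_pi.1 (hccd n) j)
      (meromorphicOn_apply_of_pi (hccm n) j) (fun z hz hz1 => by rw [(hgod n z hz hz1).2])).2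
  -- ONE call of ★ X2_χ core, generic-eigenvalue edition
  obtain ⟨Ec, qc, P, hEcNF, hqcNF, hEcE, hqcq, -, -, hPc, hPcd, hPre, -, hEan, hqan, hEdiff, hqdiff, -, hEcont⟩ :=
    chiEisenstein_meromorphic_exports_core_of_packages_of_eigen L μ νG hφc hφM 0 (fun n => n + 3) (I := I) (fun n i => (fun (i : I n) (y : (quasiSplit (↥(maximalRealSubfield L)) L (IsCMField.complexConj L) 2).Adelic) => orbitalSmoothing νG (fun x : (quasiSplit (↥(maximalRealSubfield L)) L (IsCMField.complexConj L) 2).Adelic => ((η n i (adelicVal (↥(maximalRealSubfield L)) L (IsCMField.complexConj L) 2 ((StdForm.antidiagonal 2).over L) x) : ℝ) : ℂ)) (fun x : (quasiSplit (↥(maximalRealSubfield L)) L (IsCMField.complexConj L) 2).Adelic => ((η n i (adelicVal (↥(maximalRealSubfield L)) L (IsCMField.complexConj L) 2 ((StdForm.antidiagonal 2).over L) x) : ℝ) : ℂ)) y) i)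
      (fun n i => (hconv n i).1) (fun n i => (hconv n i).2.1) (fun n i x => (hconv n i).2.2.2.1 x) ŝ hŝd (fun n _ => hcov n)
      (U := U) (fun n _ => hUo n) (fun n _ => hUD n) (fun n _ => hUcd n) vX (fun n _ => hvXd n)
      (F := fun g n => Ecb n g) (fun g n _ => hEcm n g) (fun g n _ => hEcg n g) (fun g n _ z _ hzU => hEco n g z hzU) (fun g n _ => hgerm n g)
      (q := q) hq (Fq := fun j n s => if (1 : ℝ) < s.re then q j s else cc n s j) (fun j n _ => (hpatch j n).1) (fun j n _ => (hpatch j n).2.1) (fun j n _ => (hpatch j n).2.2)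
  exact ⟨Ec, qc, P, hEcNF, hqcNF, hEcE, hqcq, hPc, hPcd, hPre, hEan, hqan, hEdiff, hqdiff, hEcont⟩

end Summit.HodgeConjecture.HodgeConjecture.Cruxes.H413.K2E1ChiEisensteinMeromorphicExportsU2GlobalCMEigen
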